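import Mathlib
import Summits.Ventures.HodgeRepro.BallGenLemmaW
import Summits.Ventures.HodgeRepro.BallTopology
import Summits.Ventures.HodgeRepro.Statements

/-!
# The general model at `p = 2` IS the sealed ball model: transport, and statement (c) from Lemma W

Blind re-derivation cell `pub-hodge-repro`, seat `typer-2` (gen 3).  The sealed `BallModel.lean` indexes `ℂ³` by
`Fin 3`; `BallGen.lean` indexes `ℂ^{p+1}` by `Fin p ⊕ Unit`.  Along `ι : Fin 2 ⊕ Unit ≃ Fin 3` (`inl i ↦ i`,
`inr () ↦ 2`) the two models match term by term: `J`, the group (`toU21 : U 2 →* U21` with inverse `ofU21`, a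
homeomorphism), the ball (`toBall`), the lift, the action, the Jacobian and the pull-back.  Consequently the sealed
statement (c) is the case `p = 2`, `i = 1` of `lemmaW_two` (`heckeTranslateWedge_of_lemmaW`), which makes the
general-`p` Lemma W machinery a third, independent proof of (c).
-/

set_option autoImplicit false

noncomputable section

namespace HodgeRepro.BallGen

open Matrix Topology
open Summit.Ventures.HodgeRepro

/-! ### The index equivalence and the reindexing of matrices -/

/-- `Fin 2 ⊕ Unit ≃ Fin 3`: `inl i ↦ i`, `inr () ↦ 2`. -/
def ι : Idx 2 ≃ Fin 3 where
  toFun := Sum.elim Fin.castSucc fun _ => 2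
  invFun j := if h : j.val < 2 then Sum.inl ⟨j.val, h⟩ else Sum.inr ()
  left_inv := fun x => by
    rcases x with i | u
    · fin_cases i <;> rfl
    · rfl
  right_inv := fun j => by fin_cases j <;> rfl

/-- `ι (inl i) = i` (as `Fin.castSucc`). -/
@[simp] theorem ι_inl (i : Fin 2) : ι (Sum.inl i) = Fin.castSucc i := rfl

/-- `ι (inr ()) = 2`. -/
@[simp] theorem ι_last : ι (last 2) = 2 := rfl

/-- `ι.symm 0 = inl 0`. -/
@[simp] theorem ι_symm_zero : ι.symm 0 = Sum.inl 0 := rfl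

/-- `ι.symm 1 = inl 1`. -/
@[simp] theorem ι_symm_one : ι.symm 1 = Sum.inl 1 := rfl

/-- `ι.symm 2 = inr ()`. -/
@[simp] theorem ι_symm_two : ι.symm 2 = last 2 := rfl

/-- `ι.symm (castSucc i) = inl i`. -/
@[simp] theorem ι_symm_castSucc (i : Fin 2) : ι.symm (Fin.castSucc i) = Sum.inl i := by
  fin_cases i <;> rfl

/-- Reindexing `Matrix (Fin 2 ⊕ Unit) (Fin 2 ⊕ Unit) ℂ ≃+* Matrix (Fin 3) (Fin 3) ℂ`. -/
abbrev reM : Matrix (Idx 2) (Idx 2) ℂ ≃+* Matrix (Fin 3) (Fin 3) ℂ := Matrix.reindexRingEquiv ℂ ι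

/-- Entries of a reindexed matrix. -/
theorem reM_apply (M : Matrix (Idx 2) (Idx 2) ℂ) (i j : Fin 3) : reM M i j = M (ι.symm i) (ι.symm j) := rfl

/-- Entries of a back-reindexed matrix. -/
theorem reM_symm_apply (M : Matrix (Fin 3) (Fin 3) ℂ) (i j : Idx 2) : reM.symm M i j = M (ι i) (ι j) := rfl

/-- `reM` commutes with the conjugate transpose. -/
theorem reM_conjTranspose (M : Matrix (Idx 2) (Idx 2) ℂ) : reM Mᴴ = (reM M)ᴴ := rfl

/-- `reM.symm` commutes with the conjugate transpose. -/
theorem reM_symm_conjTranspose (M : Matrix (Fin 3) (Fin 3) ℂ) : reM.symm Mᴴ = (reM.symm M)ᴴ := rfl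

/-- `reM J = J` (the sealed `J`). -/
theorem reM_J : reM (J 2) = BallModel.J := by
  ext i j
  fin_cases i <;> fin_cases j <;> simp [reM_apply, J, BallModel.J, Matrix.diagonal]

/-- `reM.symm J = J`. -/
theorem reM_symm_J : reM.symm BallModel.J = J 2 := by
  rw [← reM_J, RingEquiv.symm_apply_apply]

/-- Reindexed matrix-vector product: `reM M *ᵥ v = (M *ᵥ (v ∘ ι)) ∘ ι.symm`. -/
theorem reM_mulVec (M : Matrix (Idx 2) (Idx 2) ℂ) (v : Fin 3 → ℂ) :
    reM M *ᵥ v = (M *ᵥ (v ∘ ι)) ∘ ι.symm := by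
  have := Matrix.submatrix_mulVec_equiv M v ι.symm ι.symm
  simpa using this

/-! ### The group map `U(2,1) ≃ U21` -/

/-- The underlying map on `GL`. -/
abbrev toGL : GLp 2 →* BallModel.GL3 := Units.map reM.toRingHom.toMonoidHom

/-- The matrix of `toGL g` is the reindexed matrix. -/
theorem coe_toGL (g : GLp 2) : ((toGL g : BallModel.GL3) : Matrix (Fin 3) (Fin 3) ℂ) = reM (g : Matrix (Idx 2) (Idx 2) ℂ) := rfl

/-- `toGL` maps `U(2,1)` into the sealed `U21`. -/
theorem toGL_mem (g : U 2) : toGL (g : GLp 2) ∈ BallModel.U21 := by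
  show ((toGL (g : GLp 2) : BallModel.GL3) : Matrix (Fin 3) (Fin 3) ℂ)ᴴ * BallModel.J *
      ((toGL (g : GLp 2) : BallModel.GL3) : Matrix (Fin 3) (Fin 3) ℂ) = BallModel.J
  rw [coe_toGL, ← reM_conjTranspose, ← reM_J, ← map_mul, ← map_mul, mat_mem]

/-- **`toU21 : U(2,1) →* U21`**, the reindexing isomorphism onto the sealed group. -/
def toU21 : U 2 →* BallModel.U21 :=
  (toGL.comp (U 2).subtype).codRestrict BallModel.U21 toGL_mem

/-- The sealed matrix of `toU21 g` is the reindexed matrix of `g`. -/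
@[simp] theorem mat_toU21 (g : U 2) : BallModel.mat (toU21 g) = reM (mat g) := rfl

/-- The inverse direction on `GL`. -/
abbrev ofGL : BallModel.GL3 →* GLp 2 := Units.map reM.symm.toRingHom.toMonoidHom

/-- The matrix of `ofGL g`. -/
theorem coe_ofGL (g : BallModel.GL3) : ((ofGL g : GLp 2) : Matrix (Idx 2) (Idx 2) ℂ) = reM.symm (g : Matrix (Fin 3) (Fin 3) ℂ) := rfl

/-- `ofGL` maps the sealed `U21` into `U(2,1)`. -/
theorem ofGL_mem (g : BallModel.U21) : ofGL (g : BallModel.GL3) ∈ U 2 := by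
  show ((ofGL (g : BallModel.GL3) : GLp 2) : Matrix (Idx 2) (Idx 2) ℂ)ᴴ * J 2 *
      ((ofGL (g : BallModel.GL3) : GLp 2) : Matrix (Idx 2) (Idx 2) ℂ) = J 2
  rw [coe_ofGL, ← reM_symm_conjTranspose, ← reM_symm_J, ← map_mul, ← map_mul, BallModel.mat_mem]

/-- **`ofU21 : U21 →* U(2,1)`**, the inverse reindexing. -/
def ofU21 : BallModel.U21 →* U 2 :=
  (ofGL.comp BallModel.U21.subtype).codRestrict (U 2) ofGL_mem

/-- The matrix of `ofU21 g`. -/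
@[simp] theorem mat_ofU21 (g : BallModel.U21) : mat (ofU21 g) = reM.symm (BallModel.mat g) := rfl

/-- `ofU21 ∘ toU21 = id`. -/
theorem ofU21_toU21 (g : U 2) : ofU21 (toU21 g) = g := by
  apply Subtype.ext; apply Units.ext
  show reM.symm (reM (mat g)) = mat g
  exact reM.symm_apply_apply _

/-- `toU21 ∘ ofU21 = id`. -/
theorem toU21_ofU21 (g : BallModel.U21) : toU21 (ofU21 g) = g := by
  apply Subtype.ext; apply Units.ext
  show reM (reM.symm (BallModel.mat g)) = BallModel.mat g
  exact reM.apply_symm_apply _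

/-! ### The ball, the lift, the action, the Jacobian -/

/-- `𝔹²` of the general model is the sealed `Ball`. -/
def toBall : Ball 2 ≃ BallModel.Ball :=
  Equiv.subtypeEquivRight fun z => by simp [nsq, BallModel.nsq, Fin.sum_univ_two]

/-- The point of `toBall z`. -/
@[simp] theorem toBall_val (z : Ball 2) : (toBall z).1 = z.1 := rfl

/-- The point of `toBall.symm z`. -/
@[simp] theorem toBall_symm_val (z : BallModel.Ball) : (toBall.symm z).1 = z.1 := rfl

/-- The sealed lift is the reindexed lift. -/
theorem lift_toBall (z : Ball 2) : BallModel.lift (toBall z) = lift z ∘ ι.symm := by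
  ext j; fin_cases j <;> simp [BallModel.lift, lift]

/-- The sealed `W3` is the reindexed `W`. -/
theorem W3_toU21 (g : U 2) (z : Ball 2) : BallModel.W3 (toU21 g) (toBall z) = W g z ∘ ι.symm := by
  unfold BallModel.W3 W
  rw [mat_toU21, lift_toBall, reM_mulVec]
  congr 2
  ext i; simp

/-- The sealed action is the transported action. -/
theorem act_toU21 (g : U 2) (z : Ball 2) : BallModel.act (toU21 g) (toBall z) = toBall (act g z) := by
  apply Subtype.ext
  ext i
  fin_cases i <;> simp [BallModel.act, BallModel.proj, act, proj, W3_toU21]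

/-- The sealed Jacobian is the Jacobian of the general model. -/
theorem Jac_toU21 (g : U 2) (z : Ball 2) : BallModel.Jac (toU21 g) (toBall z) = Jac g z := by
  ext i j
  simp only [BallModel.Jac, Jac, Matrix.of_apply, mat_toU21, W3_toU21, Function.comp_apply, reM_apply,
    ι_symm_castSucc, ι_symm_two]

/-- The sealed pull-back `J_γ(z)ᵀ F(γ z)` is the general `pullback`. -/
theorem pullback_toU21 (g : U 2) (F : BallModel.Ball → Fin 2 → ℂ) (z : Ball 2) :
    (BallModel.Jac (toU21 g) (toBall z))ᵀ *ᵥ F (BallModel.act (toU21 g) (toBall z)) =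
      pullback g (F ∘ toBall) z := by
  rw [Jac_toU21, act_toU21]; rfl

/-! ### `mat` is inducing on `U(p,1)` (general `p`), so `toU21` is a homeomorphism -/

section Inducing

variable {p : ℕ}

/-- `mat g * mat g⁻¹ = 1`. -/
theorem mat_mul_mat_inv (g : U p) : mat g * mat g⁻¹ = 1 := by
  rw [mat, mat, Subgroup.coe_inv, Units.mul_inv]

/-- On `U(p,1)` the inverse is `g⁻¹ = J gᴴ J`. -/
theorem mat_inv (g : U p) : mat g⁻¹ = J p * (mat g)ᴴ * J p := by
  have h := mat_mem g
  have h2 : (mat g)ᴴ * J p = J p * mat g⁻¹ := by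
    calc (mat g)ᴴ * J p = (mat g)ᴴ * J p * (mat g * mat g⁻¹) := by rw [mat_mul_mat_inv, Matrix.mul_one]
      _ = ((mat g)ᴴ * J p * mat g) * mat g⁻¹ := by simp only [Matrix.mul_assoc]
      _ = J p * mat g⁻¹ := by rw [h]
  symm
  calc J p * (mat g)ᴴ * J p = J p * ((mat g)ᴴ * J p) := by rw [Matrix.mul_assoc]
    _ = J p * (J p * mat g⁻¹) := by rw [h2]
    _ = mat g⁻¹ := by rw [← Matrix.mul_assoc, J_mul_J, Matrix.one_mul]

/-- The inverse, read in `GL`, as a function of `mat g`. -/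
theorem coe_inv_eq (g : U p) : ((g : GLp p)⁻¹ : GLp p).val = J p * (mat g)ᴴ * J p := by
  rw [← mat_inv]
  rfl

/-- **`mat` is inducing** on `U(p,1)`: its topology is the one induced by the matrix entries. -/
theorem isInducing_mat : IsInducing (mat : U p → Matrix (Idx p) (Idx p) ℂ) := by
  constructor
  apply le_antisymm
  · exact continuous_iff_le_induced.1 continuous_mat
  · letI τ : TopologicalSpace (U p) := TopologicalSpace.induced mat inferInstance
    have hval : @Continuous (U p) (GLp p) τ _ (Subtype.val : U p → GLp p) := by
      rw [Units.continuous_iff]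
      constructor
      · exact continuous_induced_dom
      · have hfun : (fun g : U p => ((g : GLp p)⁻¹ : GLp p).val) = fun g => J p * (mat g)ᴴ * J p := by
          funext g
          exact coe_inv_eq g
        show @Continuous (U p) _ τ _ (fun g : U p => ((g : GLp p)⁻¹ : GLp p).val)
        rw [hfun]
        have hmat : @Continuous (U p) _ τ _ mat := continuous_induced_dom
        exact (continuous_const.matrix_mul hmat.matrix_conjTranspose).matrix_mul continuous_const
    exact continuous_iff_le_induced.1 hval

end Inducing

/-- `toU21` is continuous. -/
theorem continuous_toU21 : Continuous toU21 := by
  rw [BallModel.isInducing_mat.continuous_iff]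
  refine continuous_matrix fun i j => ?_
  exact continuous_mat.matrix_elem (ι.symm i) (ι.symm j)

/-- `ofU21` is continuous. -/
theorem continuous_ofU21 : Continuous ofU21 := by
  rw [isInducing_mat.continuous_iff]
  refine continuous_matrix fun i j => ?_
  exact BallModel.continuous_mat.matrix_elem (ι i) (ι j)

/-- **`U(2,1) ≃ₜ U21`**: the reindexing is a homeomorphism. -/
def toU21Homeo : U 2 ≃ₜ BallModel.U21 where
  toFun := toU21
  invFun := ofU21
  left_inv := ofU21_toU21
  right_inv := toU21_ofU21
  continuous_toFun := continuous_toU21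
  continuous_invFun := continuous_ofU21

/-- A dense subgroup of the sealed `U21` pulls back to a dense subgroup of `U(2,1)`. -/
theorem dense_comap_toU21 {Δ : Subgroup BallModel.U21} (hΔ : Dense (Δ : Set BallModel.U21)) :
    Dense ((Δ.comap toU21 : Subgroup (U 2)) : Set (U 2)) := by
  rw [Subgroup.coe_comap]
  exact hΔ.preimage toU21Homeo.isOpenMap

/-- `toBall` is continuous. -/
theorem continuous_toBall : Continuous toBall :=
  continuous_induced_rng.2 continuous_subtype_val

/-! ### The wedge in dimension two -/

/-- In `ℂ²`, if `u ≠ 0` and `v ∉ ℂ·u` then `v ∧ u ≠ 0`. -/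
theorem wedge_ne_zero_of_not_mem_span {u v : Fin 2 → ℂ} (hu : u ≠ 0) (hv : v ∉ Submodule.span ℂ {u}) :
    BallModel.wedge v u ≠ 0 := by
  intro hw
  apply hv
  rw [Submodule.mem_span_singleton]
  simp only [BallModel.wedge] at hw
  by_cases h0 : u 0 = 0
  · have h1 : u 1 ≠ 0 := by
      intro h1; apply hu; ext i; fin_cases i <;> simp [h0, h1]
    have hv0 : v 0 = 0 := by
      rw [h0, mul_zero, sub_eq_zero] at hw
      exact (mul_eq_zero.1 hw).resolve_right h1
    refine ⟨v 1 / u 1, ?_⟩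
    ext i; fin_cases i
    · simp [h0, hv0]
    · simp [div_mul_cancel₀ _ h1]
  · refine ⟨v 0 / u 0, ?_⟩
    ext i; fin_cases i
    · simp [div_mul_cancel₀ _ h0]
    · show v 0 / u 0 * u 1 = v 1
      field_simp
      linear_combination hw

/-! ### The sealed statement (c) from Lemma W -/

/-- **Statement (c) as the case `p = 2`, `i = 1` of Lemma W**: the sealed `HeckeTranslateWedge` follows from
`lemmaW_two` by transporting along `toU21`, `toBall`. -/
theorem heckeTranslateWedge_of_lemmaW : HeckeTranslateWedge := by
  intro Δ hΔ F G hF hG hF0 hG0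
  have hΔ' := dense_comap_toU21 hΔ
  have hF' : Continuous (F ∘ toBall) := hF.comp continuous_toBall
  have hF0' : ∃ w, (F ∘ toBall) w ≠ 0 := by
    obtain ⟨w, hw⟩ := Function.ne_iff.1 hF0
    exact ⟨toBall.symm w, by simpa using hw⟩
  have hG0' : ∃ z, (G ∘ toBall) z ≠ 0 := by
    obtain ⟨z, hz⟩ := Function.ne_iff.1 hG0
    exact ⟨toBall.symm z, by simpa using hz⟩
  obtain ⟨γ, hγ, z, hGz, hpull⟩ := lemmaW_two hΔ' hF' hF0' hG0'
  refine ⟨toU21 γ, Subgroup.mem_comap.1 hγ, toBall z, ?_⟩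
  rw [pullback_toU21]
  exact wedge_ne_zero_of_not_mem_span hGz hpull

end HodgeRepro.BallGen

end
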